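import Summits.Ventures.PercRepro.RankLevelSetO
import Summits.Ventures.PercRepro.TheoremNAll
import Summits.Ventures.PercRepro.MatroidMidCount

/-!
# PercRepro — Theorem O on every matroid: the `|E|`-induction wrapper (p2, gen 5)

`proofs/MINE2-RLS.md` §16 Step 0: C-025 at `(5, 3)` holds on every finite matroid by strong induction on `|E|`:
* a LOOP halves both counts (p3's `ncard_U_eq_two_mul_of_loop` / `ncard_Y_eq_two_mul_of_loop`);
* a PARALLEL PAIR is Theorem F (p3's `c025_step_of_delete_contract`) with the induction hypothesis at `(5, 3)` on
  `M ＼ {e}` and `(4, 2)` on `M ／ {e}` — Theorem N at `p = 4` (`c025_of_q_two`), `Φ(4, 2) = 4/3 ≥ 5/4`;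
* a COLOOP at `ρ(E) = 5`: `#U_M(5,3) = #U_{M′}(4,3)` and `#Y_M(5,3) = W₄(M′) + W₃(M′) ≥ 2·#U_{M′}(4,3)`
  (typer-2's `topCount_eq_of_isColoop_of_eRank`, `levelCount_succ_eq_of_isColoop`, `topCount_le_levelCount_*`);
* `ρ(E) < 5` makes `U(5, 3)` empty; otherwise `M` is simple with `ρ(E) ≥ 5`, coloop-free when `ρ(E) = 5`, and Step 2
  applies (`c025_five_three_of_simple`).

**`c025_five_three`**: C-025 at `(5, 3)` for every finite matroid — with `c025_of_q_zero` / `c025_of_q_one` /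
`c025_of_q_two`, the first `q = 3` case of the rank level-set inequality is kernel-checked.
-/

open scoped Matroid

namespace PercRepro

namespace ThmO

open Finset Set ThmN

variable {α : Type}

/-- The loop step at `(5, 3)` (p3's halving lemmas). -/
theorem RLS_five_three_of_loop (M : Matroid α) [M.Finite] {e : α} (he : M.IsLoop e)
    (h : RLS (M ＼ {e}) 5 3) : RLS M 5 3 := by
  unfold RLS at h ⊢
  have he' : e ∈ M.loops := he
  rw [ncard_U_eq_two_mul_of_loop he' 5 3, ncard_Y_eq_two_mul_of_loop he' 5 3]
  push_cast at h ⊢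
  linarith

/-- The coloop step at `(5, 3)`: `#Y_M = W₄(M′) + W₃(M′) ≥ 2·#U_{M′}(4, 3) = 2·#U_M ≥ (5/4)·#U_M`. -/
theorem RLS_five_three_of_coloop (M : Matroid α) [M.Finite] {e : α} (he : M.IsColoop e)
    (hR : M.eRank = (5 : ℕ)) : RLS M 5 3 := by
  classical
  have hU : Matroid.topCount M (4 + 1) (2 + 1) = Matroid.topCount (M.delete {e}) 4 (2 + 1) :=
    Matroid.topCount_eq_of_isColoop_of_eRank he 2 hR
  have hY : Matroid.midCount M (4 + 1) 3 = Matroid.levelCount M 4 := by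
    rw [Matroid.midCount_eq_sum (4 + 1) 3 (by omega), show Finset.Ioo 3 (4 + 1) = {4} from by decide,
      Finset.sum_singleton]
  have hlev : Matroid.levelCount M (3 + 1) = Matroid.levelCount (M ＼ {e}) (3 + 1) +
      Matroid.levelCount (M ＼ {e}) 3 := Matroid.levelCount_succ_eq_of_isColoop he 3
  have htop : Matroid.topCount (M.delete {e}) 4 3 ≤ Matroid.levelCount (M.delete {e}) 4 :=
    Matroid.topCount_le_levelCount_top 4 3
  have hbot : Matroid.topCount (M.delete {e}) 4 3 ≤ Matroid.levelCount (M.delete {e}) 3 :=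
    Matroid.topCount_le_levelCount_bot 4 3
  -- translate to the C025 body
  show phiK 5 3 * (Matroid.topCount M 5 3 : ℚ) ≤ (Matroid.midCount M 5 3 : ℚ)
  rw [phiK_five_three]
  have hU' : Matroid.topCount M 5 3 = Matroid.topCount (M.delete {e}) 4 3 := hU
  have hY' : Matroid.midCount M 5 3 = Matroid.levelCount (M.delete {e}) 4 + Matroid.levelCount (M.delete {e}) 3 := by
    rw [show (5 : ℕ) = 4 + 1 from rfl, hY]
    exact hlev
  rw [hU', hY']
  push_cast
  have h1 : (Matroid.topCount (M.delete {e}) 4 3 : ℚ) ≤ Matroid.levelCount (M.delete {e}) 4 := by exact_mod_cast htop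
  have h2 : (Matroid.topCount (M.delete {e}) 4 3 : ℚ) ≤ Matroid.levelCount (M.delete {e}) 3 := by exact_mod_cast hbot
  have h0 : (0 : ℚ) ≤ Matroid.topCount (M.delete {e}) 4 3 := by positivity
  linarith

/-- Theorem F's step at `(5, 3)`: a parallel pair reduces `RLS M 5 3` to `RLS (M ＼ {e}) 5 3` and `(4, 2)` on
`M ／ {e}`, which is Theorem N. -/
theorem RLS_five_three_of_parallel (M : Matroid α) [M.Finite] {e e' : α} (he : M.Indep {e})
    (he' : e' ∈ M.E) (hne : e' ≠ e) (hpar : e ∈ M.closure {e'}) (h1 : RLS (M ＼ {e}) 5 3) : RLS M 5 3 := by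
  have key := c025_step_of_delete_contract he (spans_of_parallel he' hne hpar) 4 2
  have h2 : RLS (M ／ {e}) 4 2 := c025_two_all (M ／ {e}) 4 (le_refl 4)
  unfold RLS at h1 h2 ⊢
  simp only [show (4 + 1 : ℕ) = 5 from rfl, show (2 + 1 : ℕ) = 3 from rfl] at key
  exact key h1 h2

/-- **Theorem O (mine-2, `MINE2-RLS.md` §16): C-025 at `(5, 3)` on EVERY finite matroid** — strong induction on
`|E|`: loops halve, parallel pairs by Theorem F + Theorem N at `p = 4`, a coloop at `ρ(E) = 5` by the coloop step,
`ρ(E) < 5` trivially, the simple coloop-free core by Step 2. -/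
theorem c025_five_three_all (M : Matroid α) [M.Finite] : RLS M 5 3 := by
  suffices H : ∀ n : ℕ, ∀ (M : Matroid α) [M.Finite], M.E.ncard = n → RLS M 5 3 from H _ M rfl
  intro n
  induction n using Nat.strong_induction_on with
  | _ n ih =>
  intro M _ hn
  classical
  have hdel : ∀ e ∈ M.E, (M ＼ {e}).E.ncard < n := by
    intro e he
    rw [Matroid.delete_ground, ← hn, ← Set.ncard_sdiff_singleton_add_one he M.ground_finite]
    omega
  -- Case 1: a loop
  by_cases hL : ∃ e ∈ M.E, M.IsLoop e
  · obtain ⟨e, he, hloopE⟩ := hL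
    exact RLS_five_three_of_loop M hloopE (ih _ (hdel e he) (M ＼ {e}) rfl)
  push Not at hL
  -- Case 2: a parallel pair
  by_cases hP : ∃ e ∈ M.E, ∃ e' ∈ M.E, e' ≠ e ∧ e ∈ M.closure {e'}
  · obtain ⟨e, he, e', he', hne, hpar⟩ := hP
    have heI : M.Indep {e} := Matroid.indep_singleton.2 ((Matroid.not_isLoop_iff he).1 (hL e he))
    exact RLS_five_three_of_parallel M heI he' hne hpar (ih _ (hdel e he) (M ＼ {e}) rfl)
  push Not at hP
  -- Case 3: simple
  have hs : ∀ e ∈ M.E, ∀ f ∈ M.E, e ≠ f → M.eRk {e, f} = 2 :=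
    fun e he f hf hef => eRk_pair_eq_two_of_simple M hL (fun e he e' he' hne => hP e he e' he' hne) he hf hef
  rcases lt_or_ge M.eRank (5 : ℕ∞) with hlt | hge
  · exact RLS_of_eRank_lt M (p := 5) (q := 3) (by exact_mod_cast hlt)
  by_cases hC : M.eRank = 5 ∧ ∃ e, M.IsColoop e
  · obtain ⟨hR, e, hcol⟩ := hC
    exact RLS_five_three_of_coloop M hcol (by exact_mod_cast hR)
  · have hcolfree : M.eRank = 5 → ∀ e, ¬ M.IsColoop e := fun hR e hcol => hC ⟨hR, e, hcol⟩
    exact c025_five_three_of_simple M hs hge hcolfree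

end ThmO

/-- **C-025 at `(5, 3)` for every finite matroid** (mine-2 Theorem O):
`phiK 5 3 · #{A ⊆ E : ρ(A) = 5, ρ(E ∖ A) = 3} ≤ #{A ⊆ E : 3 < ρ(A) < 5}` — the body of `C025` at `(5, 3)`, no
hypothesis. -/
theorem c025_five_three {α : Type} (M : Matroid α) [M.Finite] :
    phiK 5 3 * ({A : Set α | A ⊆ M.E ∧ M.eRk A = ((5 : ℕ) : ℕ∞) ∧ M.eRk (M.E \ A) = ((3 : ℕ) : ℕ∞)}.ncard : ℚ) ≤
      ({A : Set α | A ⊆ M.E ∧ ((3 : ℕ) : ℕ∞) < M.eRk A ∧ M.eRk A < ((5 : ℕ) : ℕ∞)}.ncard : ℚ) := by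
  have h := ThmO.c025_five_three_all M
  unfold ThmN.RLS at h
  exact h

end PercRepro
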